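import Literature.Probability.LatticeModels.TwistCorr
import HarnessLib

/-!
# The twisted free box is a relabelled bicrystal: the transport identity

Topic `Literature/Probability/LatticeModels`; companion (c) of the definition request `defn-twistCorr`
of route VolterraWard (`Summits/CriticalPhenomena/Ising3DConformalLimit`; the first, "provable now",
half of its crux `WallDecay`, item 7040), for the objects of `TwistCorr.lean`.

The twisted graph of `TwistCorr.lean` (bond relation `twistAdj W M A`: planar nearest-neighbour
bonds in the layers `z ≤ A`, bonds pulled back by the brickwork map `F = brickworkMap W M` in the
layers `z > A`, straight vertical bonds) is the RELABELLING, by the height-split bijection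
`Φ = wallRelabel W M A : ℤ³ → ℤ³` (the identity on `{z ≤ A}`, `F` on `{z > A}`; `F` preserves
heights and is a bijection of every layer, `brickworkEquiv`), of the **bicrystal** of the idea card
behind the route: `ℤ³` CUT between the layers `A` and `A + 1` and RE-GLUED by `F`, i.e. the graph
`bicrystalGraph W M A` on `ℤ³` with the nearest-neighbour bonds inside `{z ≤ A}` and inside
`{z > A}` and, across the cut, the bonds `(p₀, p₁, A) — (F(p)₀, F(p)₁, A + 1)` — the lattice
picture of a twist boundary: the solid above the boundary plane rotated, relative to the solid below,
about the normal axis (Cai–Nix 2016, §14.2.2, Fig. 14.9c and eq. (14.25) `θ ≈ b/s`, PDF p. 458; the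
rotation being discretised by `F`, `BrickworkMap.lean`). Precisely:
`twistAdj W M A x y ↔ bicrystalGraph.Adj (Φ x) (Φ y)` (`twistAdj_iff_bicrystalAdj`), whence, by
transport of structure of the finite Gibbs average (`PairIsing.avg_comp_equiv`) and the
identification of nearest-neighbour pair couplings with the free Ising state
(`PairIsing.avg_adj_eq_isingExpect_free`), the **transport identity**
`twistCorr N W M A n y = ⟨∏ᵢ σ_{Φ(yᵢ)}⟩^∅_{Φ(box 3 N); β_c(3), 0}` on the bicrystal
(`twistCorr_eq_isingExpect_bicrystal`); for a wall below every insertion, `Φ(yᵢ) = F(yᵢ)`: the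
twisted correlator is the bicrystal correlator AT THE TRANSPORTED SITES
(`twistCorr_eq_isingExpect_bicrystal_of_lt`).

## Contents (all proved)

* `wallRelabel`, `wallRelabelInv`, `wallRelabelEquiv` (+ coordinate / case lemmas);
* `bicrystalAdj`, `bicrystalGraph` (a `SimpleGraph (Site 3)`, decidable and locally finite:
  `glueUp`, `glueDown` are the two possible glue partners of a site), `bicrystalAdj_iff_of_le_of_le`,
  `bicrystalAdj_iff_of_lt_of_lt` (away from the cut the bicrystal is `ℤ³`),
  `bicrystalAdj_zero_right_iff` (`M = 0`: the bicrystal is `ℤ³`);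
* `twistAdj_iff_bicrystalAdj`, `twistCouplings_eq_bicrystal`,
  `twistCorr_eq_isingExpect_bicrystal`, `twistCorr_eq_isingExpect_bicrystal_of_lt`.

## References

* W. Cai, W. D. Nix, *Imperfections in Crystalline Solids*, CUP (2016), §14.2.2, Fig. 14.9c,
  eq. (14.25) (a low angle twist boundary = two perpendicular screw dislocation arrays = the solid
  above the slip plane rotated about the normal by `θ ≈ b/s`; read: PDF pp. 456–459) [CaiNix2016].
* S. Friedli, Y. Velenik, *Statistical Mechanics of Lattice Systems*, CUP (2017), §3.1 eq. (3.8)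
  (free boundary condition on a finite graph) [FriedliVelenik2017].
* Route `CriticalPhenomena/VolterraWard`, crux `WallDecay` (−): "exact transport by the graph
  isomorphism `F × id` of the pulled-back region onto `ℤ³`".

## Design / not here

No named facts. The bicrystal is a graph on the SAME vertex set `ℤ³` (the card's convention: sites
keep their names, bonds are re-glued), so its free-box correlators are the tree's `isingExpect` on
the finite sets `Φ(box 3 N) = (box 3 N).map Φ`; these are not boxes, and nothing is claimed here
about their `N → ∞` limit or about the decay of the wall's influence (the open half of `WallDecay`).
-/

noncomputable section

open Finset

namespace Literature.Probability.LatticeModels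

variable (W : ℕ) (M A : ℤ)

/-! ### The wall relabelling `Φ` -/

/-- The **wall relabelling** `Φ_{W,M,A} : ℤ³ → ℤ³`: the identity on the layers `z ≤ A` and the
brickwork map `F_{W,M}` on the layers `z > A` (the upper half-crystal rotated by the discretised
rotation `F`). [cite: CaiNix2016, §14.2.2] -/
def wallRelabel (x : Site 3) : Site 3 := if x 2 ≤ A then x else brickworkMap W M x

/-- Below the wall `Φ` is the identity. [folklore] -/
theorem wallRelabel_of_le {x : Site 3} (h : x 2 ≤ A) : wallRelabel W M A x = x := if_pos h

/-- Above the wall `Φ` is the brickwork map. [folklore] -/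
theorem wallRelabel_of_lt {x : Site 3} (h : A < x 2) : wallRelabel W M A x = brickworkMap W M x :=
  if_neg (not_le.2 h)

/-- `Φ` preserves heights. [folklore] -/
@[simp] theorem wallRelabel_apply_two (x : Site 3) : wallRelabel W M A x 2 = x 2 := by
  unfold wallRelabel
  split_ifs <;> simp

/-- The inverse brickwork map preserves heights. [folklore] -/
@[simp] theorem brickworkInv_apply_two (r : Site 3) : brickworkInv W M r 2 = r 2 := by
  simp [brickworkInv]

/-- The inverse wall relabelling: the identity on `z ≤ A`, `F⁻¹` on `z > A`. [folklore] -/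
def wallRelabelInv (u : Site 3) : Site 3 := if u 2 ≤ A then u else brickworkInv W M u

/-- `Φ⁻¹ ∘ Φ = id`. [folklore] -/
theorem wallRelabelInv_wallRelabel (x : Site 3) : wallRelabelInv W M A (wallRelabel W M A x) = x := by
  unfold wallRelabelInv
  by_cases h : x 2 ≤ A
  · rw [wallRelabel_of_le W M A h, if_pos h]
  · rw [wallRelabel_of_lt W M A (not_le.1 h), brickworkMap_apply_two, if_neg h,
      brickworkInv_brickworkMap]

/-- `Φ ∘ Φ⁻¹ = id`. [folklore] -/
theorem wallRelabel_wallRelabelInv (u : Site 3) : wallRelabel W M A (wallRelabelInv W M A u) = u := by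
  unfold wallRelabel wallRelabelInv
  by_cases h : u 2 ≤ A
  · rw [if_pos h, if_pos h]
  · rw [if_neg h, brickworkInv_apply_two, if_neg h, brickworkMap_brickworkInv]

/-- The wall relabelling as a permutation of `ℤ³`. [folklore] -/
def wallRelabelEquiv : Site 3 ≃ Site 3 where
  toFun := wallRelabel W M A
  invFun := wallRelabelInv W M A
  left_inv := wallRelabelInv_wallRelabel W M A
  right_inv := wallRelabel_wallRelabelInv W M A

/-- `wallRelabelEquiv` is `wallRelabel` as a function. [folklore] -/
@[simp] theorem coe_wallRelabelEquiv : ⇑(wallRelabelEquiv W M A) = wallRelabel W M A := rfl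

/-- `Φ` is injective. [folklore] -/
theorem wallRelabel_injective : Function.Injective (wallRelabel W M A) :=
  (wallRelabelEquiv W M A).injective

/-- No twist: `Φ` is the identity. [folklore] -/
@[simp] theorem wallRelabel_zero_right (W : ℕ) (A : ℤ) (x : Site 3) : wallRelabel W 0 A x = x := by
  unfold wallRelabel
  split_ifs <;> simp

/-! ### The bicrystal graph -/

/-- The **bicrystal bond relation**: `ℤ³` cut between the layers `A` and `A + 1` and re-glued by the
brickwork map — nearest-neighbour bonds inside `{z ≤ A}` and inside `{z > A}`, and across the cut
the bonds `(p₀, p₁, A) — (F(p)₀, F(p)₁, A + 1)` (in both orientations). [cite: CaiNix2016, §14.2.2] -/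
def bicrystalAdj (u v : Site 3) : Prop :=
  (u 2 ≤ A ∧ v 2 ≤ A ∧ (zdGraph 3).Adj u v) ∨ (A < u 2 ∧ A < v 2 ∧ (zdGraph 3).Adj u v) ∨
    (u 2 = A ∧ v 2 = A + 1 ∧ v 0 = brickworkMap W M u 0 ∧ v 1 = brickworkMap W M u 1) ∨
    (v 2 = A ∧ u 2 = A + 1 ∧ u 0 = brickworkMap W M v 0 ∧ u 1 = brickworkMap W M v 1)

/-- The bicrystal bond relation is symmetric. [folklore] -/
theorem bicrystalAdj_symm {u v : Site 3} (h : bicrystalAdj W M A u v) : bicrystalAdj W M A v u := by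
  rcases h with ⟨h1, h2, h3⟩ | ⟨h1, h2, h3⟩ | h | h
  · exact Or.inl ⟨h2, h1, h3.symm⟩
  · exact Or.inr (Or.inl ⟨h2, h1, h3.symm⟩)
  · exact Or.inr (Or.inr (Or.inr h))
  · exact Or.inr (Or.inr (Or.inl h))

/-- The bicrystal bond relation is symmetric (iff form). [folklore] -/
theorem bicrystalAdj_comm (u v : Site 3) : bicrystalAdj W M A u v ↔ bicrystalAdj W M A v u :=
  ⟨bicrystalAdj_symm W M A, bicrystalAdj_symm W M A⟩

/-- No loops in the bicrystal. [folklore] -/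
theorem bicrystalAdj_irrefl (u : Site 3) : ¬ bicrystalAdj W M A u u := by
  rintro (⟨-, -, h⟩ | ⟨-, -, h⟩ | ⟨h1, h2, -⟩ | ⟨h1, h2, -⟩)
  · exact h.ne rfl
  · exact h.ne rfl
  · omega
  · omega

/-- The **bicrystal** as a simple graph on `ℤ³`. [cite: CaiNix2016, §14.2.2] -/
def bicrystalGraph : SimpleGraph (Site 3) where
  Adj := bicrystalAdj W M A
  symm := ⟨fun _ _ h => bicrystalAdj_symm W M A h⟩
  loopless := ⟨fun u h => bicrystalAdj_irrefl W M A u h⟩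

/-- Adjacency of `bicrystalGraph` is `bicrystalAdj` (definitional). [folklore] -/
theorem bicrystalGraph_adj (u v : Site 3) : (bicrystalGraph W M A).Adj u v ↔ bicrystalAdj W M A u v :=
  Iff.rfl

/-- The bicrystal bond relation is decidable. [folklore] -/
instance bicrystalAdj.instDecidable (u v : Site 3) : Decidable (bicrystalAdj W M A u v) := by
  unfold bicrystalAdj; infer_instance

/-- Adjacency in the bicrystal is decidable. [folklore] -/
instance bicrystalGraph.instDecidableRel : DecidableRel (bicrystalGraph W M A).Adj :=
  fun u v => bicrystalAdj.instDecidable W M A u v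

/-- The glue partner above: `(F(u)₀, F(u)₁, A + 1)`. [folklore] -/
def glueUp (u : Site 3) : Site 3 := fun i => if i = 2 then A + 1 else brickworkMap W M u i

/-- The glue partner below: the site `v` of the layer `A` with `(F(v)₀, F(v)₁) = (u₀, u₁)`, i.e.
`F⁻¹ (u₀, u₁, A)`. [folklore] -/
def glueDown (u : Site 3) : Site 3 := brickworkInv W M fun i => if i = 2 then A else u i

/-- A site glued above `u` is `glueUp u`. [folklore] -/
theorem eq_glueUp {u v : Site 3} (h2 : v 2 = A + 1) (h0 : v 0 = brickworkMap W M u 0)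
    (h1 : v 1 = brickworkMap W M u 1) : v = glueUp W M A u := by
  funext i
  fin_cases i
  · simpa [glueUp] using h0
  · simpa [glueUp] using h1
  · simpa [glueUp] using h2

/-- A site glued below `u` is `glueDown u`. [folklore] -/
theorem eq_glueDown {u v : Site 3} (h2 : v 2 = A) (h0 : u 0 = brickworkMap W M v 0)
    (h1 : u 1 = brickworkMap W M v 1) : v = glueDown W M A u := by
  have hF : brickworkMap W M v = fun i => if i = 2 then A else u i := by
    funext i
    fin_cases i
    · simpa using h0.symm
    · simpa using h1.symm
    · simpa using h2
  calc v = brickworkInv W M (brickworkMap W M v) := (brickworkInv_brickworkMap W M v).symm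
    _ = glueDown W M A u := by rw [hF]; rfl

/-- The bicrystal is locally finite: the neighbours of `u` are among its `ℤ³`-neighbours and its two
possible glue partners. [folklore] -/
instance bicrystalGraph.instLocallyFinite : (bicrystalGraph W M A).LocallyFinite := fun u =>
  Fintype.ofFinset
    ((((zdGraph 3).neighborFinset u) ∪ {glueUp W M A u, glueDown W M A u}).filter
      fun v => (bicrystalGraph W M A).Adj u v)
    (by
      intro v
      simp only [mem_filter, mem_union, mem_insert, mem_singleton, SimpleGraph.mem_neighborFinset,
        SimpleGraph.mem_neighborSet, and_iff_right_iff_imp]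
      intro h
      rcases h with ⟨-, -, h⟩ | ⟨-, -, h⟩ | ⟨-, h2, h0, h1⟩ | ⟨h2, -, h0, h1⟩
      · exact Or.inl h
      · exact Or.inl h
      · exact Or.inr (Or.inl (eq_glueUp W M A h2 h0 h1))
      · exact Or.inr (Or.inr (eq_glueDown W M A h2 h0 h1)))

/-- Inside the lower half-crystal the bicrystal is `ℤ³`. [folklore] -/
theorem bicrystalAdj_iff_of_le_of_le {u v : Site 3} (hu : u 2 ≤ A) (hv : v 2 ≤ A) :
    bicrystalAdj W M A u v ↔ (zdGraph 3).Adj u v := by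
  unfold bicrystalAdj
  constructor
  · rintro (⟨-, -, h⟩ | ⟨h, -, -⟩ | ⟨-, h, -⟩ | ⟨-, h, -⟩)
    · exact h
    · exact absurd hu (not_le.2 h)
    · omega
    · omega
  · exact fun h => Or.inl ⟨hu, hv, h⟩

/-- Inside the upper half-crystal the bicrystal is `ℤ³`. [folklore] -/
theorem bicrystalAdj_iff_of_lt_of_lt {u v : Site 3} (hu : A < u 2) (hv : A < v 2) :
    bicrystalAdj W M A u v ↔ (zdGraph 3).Adj u v := by
  unfold bicrystalAdj
  constructor
  · rintro (⟨h, -, -⟩ | ⟨-, -, h⟩ | ⟨h, -, -⟩ | ⟨h, -, -⟩)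
    · exact absurd hu (not_lt.2 h)
    · exact h
    · omega
    · omega
  · exact fun h => Or.inr (Or.inl ⟨hu, hv, h⟩)

/-! ### The twisted graph is the relabelled bicrystal -/

/-- The case of a lower end below the wall. [folklore] -/
private theorem twistAdj_iff_bicrystalAdj_of_le {x : Site 3} (hx : x 2 ≤ A) (y : Site 3) :
    twistAdj W M A x y ↔ bicrystalAdj W M A (wallRelabel W M A x) (wallRelabel W M A y) := by
  rcases le_or_gt (y 2) A with hy | hy
  · rw [wallRelabel_of_le W M A hx, wallRelabel_of_le W M A hy, twistAdj_iff_of_le hx,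
      bicrystalAdj_iff_of_le_of_le W M A hx hy]
  · rw [wallRelabel_of_le W M A hx, wallRelabel_of_lt W M A hy, twistAdj_iff_of_le_of_lt hx hy]
    unfold bicrystalAdj
    simp only [brickworkMap_apply_two]
    have hpl := brickworkMap_planar_eq_iff W M y x
    constructor
    · rintro ⟨h0, h1, h2⟩
      obtain ⟨h0', h1'⟩ := hpl.2 ⟨h0.symm, h1.symm⟩
      exact Or.inr (Or.inr (Or.inl ⟨by omega, by omega, h0', h1'⟩))
    · rintro (⟨-, h, -⟩ | ⟨h, -, -⟩ | ⟨h2x, h2y, h0, h1⟩ | ⟨h, -, -⟩)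
      · exact absurd hy (not_lt.2 h)
      · exact absurd hx (not_le.2 h)
      · obtain ⟨h0', h1'⟩ := hpl.1 ⟨h0, h1⟩
        exact ⟨h0'.symm, h1'.symm, by omega⟩
      · omega

/-- **The twisted graph is the relabelled bicrystal**: `x, y` are joined in the twisted graph of
`TwistCorr.lean` iff `Φ x, Φ y` are joined in the bicrystal (the identity below the wall, the graph
isomorphism `F × id` of the pulled-back upper region onto the upper half-crystal, and the straight
vertical bonds across the wall becoming the glue bonds). [cite: CaiNix2016, §14.2.2] -/
theorem twistAdj_iff_bicrystalAdj (x y : Site 3) :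
    twistAdj W M A x y ↔ bicrystalAdj W M A (wallRelabel W M A x) (wallRelabel W M A y) := by
  rcases le_or_gt (x 2) A with hx | hx
  · exact twistAdj_iff_bicrystalAdj_of_le W M A hx y
  rcases le_or_gt (y 2) A with hy | hy
  · rw [twistAdj_comm, bicrystalAdj_comm]
    exact twistAdj_iff_bicrystalAdj_of_le W M A hy x
  · rw [wallRelabel_of_lt W M A hx, wallRelabel_of_lt W M A hy, twistAdj_iff_of_lt hx,
      bicrystalAdj_iff_of_lt_of_lt W M A (by simpa using hx) (by simpa using hy)]

/-- No twist: the bicrystal is `ℤ³` (re-gluing by the identity). [folklore] -/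
theorem bicrystalAdj_zero_right_iff (W : ℕ) (A : ℤ) (u v : Site 3) :
    bicrystalAdj W 0 A u v ↔ (zdGraph 3).Adj u v := by
  rw [← twistAdj_zero_right_iff W A u v, twistAdj_iff_bicrystalAdj, wallRelabel_zero_right,
    wallRelabel_zero_right]

/-- The couplings of the twisted free box are the nearest-neighbour couplings `β_c(3)/2 · 𝟙{Φ a ∼ Φ b}`
of the bicrystal read through `Φ`. [cite: CaiNix2016, §14.2.2] -/
theorem twistCouplings_eq_bicrystal (N : ℕ) (a b : ↥(box 3 N)) :
    twistCouplings N W M A a b =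
      if (bicrystalGraph W M A).Adj (wallRelabel W M A a.1) (wallRelabel W M A b.1)
      then criticalBeta 3 / 2 else 0 := by
  rw [twistCouplings_eq_ite]
  exact if_congr (twistAdj_iff_bicrystalAdj W M A a.1 b.1) rfl rfl

/-! ### The transport identity -/

/-- **Transport identity** (finite volume, exact): for insertion sites inside the box, the critical
correlator of the twisted free box equals the free-boundary, zero-field critical Ising expectation,
on the BICRYSTAL and in the relabelled box `Φ(box 3 N)`, of the spin monomial at the relabelled
sites `Φ(yᵢ)`: `twistCorr N W M A n y = ⟨∏ᵢ σ_{Φ(yᵢ)}⟩^∅_{Φ(box 3 N); β_c(3), 0}` (transport of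
structure along `Φ : box 3 N ≃ Φ(box 3 N)`, `PairIsing.avg_comp_equiv`, and
`PairIsing.avg_adj_eq_isingExpect_free`). [cite: FriedliVelenik2017, §3.1, eq. (3.8)] -/
theorem twistCorr_eq_isingExpect_bicrystal {N n : ℕ} {y : Fin n → Site 3} (hy : ∀ i, y i ∈ box 3 N) :
    twistCorr N W M A n y =
      isingExpect (bicrystalGraph W M A) ((box 3 N).map (wallRelabelEquiv W M A).toEmbedding)
        (criticalBeta 3) 0 .free (spinMonomial (wallRelabel W M A ∘ y)) := by
  set Λ' : Finset (Site 3) := (box 3 N).map (wallRelabelEquiv W M A).toEmbedding with hΛ'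
  let eN : ↥(box 3 N) ≃ ↥Λ' := (wallRelabelEquiv W M A).subtypeEquiv fun x => (Finset.mem_map' _).symm
  have hyΛ : ∀ i, wallRelabel W M A (y i) ∈ Λ' := fun i =>
    (Finset.mem_map' (wallRelabelEquiv W M A).toEmbedding).2 (hy i)
  let c : ↥Λ' → ↥Λ' → ℝ := fun u v =>
    if (bicrystalGraph W M A).Adj u v then criticalBeta 3 / 2 else 0
  let f : SpinConfig ↥Λ' → ℝ := fun t => ∏ i, spinAt (⟨wallRelabel W M A (y i), hyΛ i⟩ : ↥Λ') t
  have hc : twistCouplings N W M A = fun a b => c (eN a) (eN b) := by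
    funext a b
    exact twistCouplings_eq_bicrystal W M A N a b
  have hobs : (fun s : SpinConfig ↥(box 3 N) =>
      ∏ i, (if h : y i ∈ box 3 N then spinAt (⟨y i, h⟩ : ↥(box 3 N)) s else 0)) =
        fun s => f (s ∘ eN.symm) := by
    funext s
    refine Finset.prod_congr rfl fun i _ => ?_
    have hsymm : eN.symm ⟨wallRelabel W M A (y i), hyΛ i⟩ = ⟨y i, hy i⟩ := eN.symm_apply_eq.2 rfl
    rw [dif_pos (hy i)]
    simp only [spinAt, Function.comp_apply, hsymm]
  calc twistCorr N W M A n y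
      = PairIsing.avg (fun a b => c (eN a) (eN b)) (fun s => f (s ∘ eN.symm)) := by
        rw [twistCorr, hc, hobs]
    _ = PairIsing.avg c f := PairIsing.avg_comp_equiv eN c f
    _ = isingExpect (bicrystalGraph W M A) Λ' (criticalBeta 3) 0 .free (fun σ => f fun a => σ a) :=
        PairIsing.avg_adj_eq_isingExpect_free (bicrystalGraph W M A) Λ' (criticalBeta 3) f
    _ = isingExpect (bicrystalGraph W M A) Λ' (criticalBeta 3) 0 .free
          (spinMonomial (wallRelabel W M A ∘ y)) := by
        congr 1

/-- **Transport identity for a wall below every insertion**: if all the insertion sites lie above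
the wall (`A < (yᵢ)₂`), the relabelled sites are the TRANSPORTED sites `F(yᵢ)`:
`twistCorr N W M A n y = ⟨∏ᵢ σ_{F(yᵢ)}⟩^∅_{Φ(box 3 N); β_c(3), 0}` on the bicrystal — the exact,
kinematic part of crux `WallDecay` (−) of route VolterraWard. [cite: CaiNix2016, §14.2.2] -/
theorem twistCorr_eq_isingExpect_bicrystal_of_lt {N n : ℕ} {y : Fin n → Site 3}
    (hy : ∀ i, y i ∈ box 3 N) (hA : ∀ i, A < y i 2) :
    twistCorr N W M A n y =
      isingExpect (bicrystalGraph W M A) ((box 3 N).map (wallRelabelEquiv W M A).toEmbedding)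
        (criticalBeta 3) 0 .free (spinMonomial (brickworkMap W M ∘ y)) := by
  have h : wallRelabel W M A ∘ y = brickworkMap W M ∘ y :=
    funext fun i => wallRelabel_of_lt W M A (hA i)
  rw [twistCorr_eq_isingExpect_bicrystal W M A hy, h]

end Literature.Probability.LatticeModels

end
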